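import Summits.ResolutionOfSingularities.ResolutionOfSingularities.Theorems.FibrewiseClosedPoints.Negative.AlmostDecoration
import Literature.AlgebraicGeometry.Resolution.PowerSeriesRegularLocal

/-!
# `FibrewiseClosedPoints` — negative lemmas III: the conclusion `OneShot` is not
junk-satisfiable (principal centres never resolve; a certified singular curve in every
characteristic)

Support (negative) lemmas for crux `stmt-ResolutionOfSingularities-15960`
(`Summit.ResolutionOfSingularities.ResolutionOfSingularities.Theses.SectionAscent.FibrewiseClosedPoints`,
route SectionAscent: `∀ p prime, ∀ d, OneShot p d → Almost p (d+1) → OneShot p (d+1)`), filed by the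
standing crux disprover (cdisprove, cycle 1, 2026-08-17). No definition of a `Prop` is declared and
no declaration concludes a route decl positively.

The landed `Negative/AlmostDecoration.lean` shows that the HYPOTHESIS `Almost p (d+1)` of the crux is
met by junk — a principal centre `(f)` on a normal variety (`almostBody_span_singleton`: `Bl_(f) ≅
Spec A`, fibre clause vacuous). This file certifies the complementary fact about the CONCLUSION
`OneShot p (d+1)`: a principal centre NEVER has a regular blowing up at a singular variety, and
singular varieties exist at the first level where the conclusion has content (`d + 1 = 2`, curves),
in every characteristic. So any proof of the crux must manufacture, from level `2` on, centres that
are not invertible at the singular points (for `V(I) = Sing` at a normal singular point this is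
Krull's Hauptidealsatz; here it is shown even for the WEAK conclusion, with no support condition).

* `irreducible_nodalCubic`, `isDomain_nodalCubic`, `nodalCubic_mem_ker_evalEval_sq`,
  `isMaximal_ker_evalEval`, `ringKrullDim_nodalCubic_lt_two` — the nodal cubic
  `f = Y² - X²(X - 1) ∈ k[X][Y]` over ANY field `k`: irreducible (Eisenstein at the prime `(X - 1)`
  of `k[X]`: `f` is monic in `Y`, its constant term `-X²(X-1)` lies in `(X-1)` but not in `(X-1)²`
  since `1` is not a root of `X²`), so `k[X][Y]/(f)` is a domain; `f ∈ 𝔪_0²` for the maximal ideal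
  `𝔪_0 = ker (evalEval 0 0)` of the origin; `dim k[X][Y]/(f) < 2`.
* `exists_not_isRegularLocalRing_of_mem_sq` — generic singular-point lemma: in a regular domain
  `C`, `0 ≠ f ∈ Q²` with `Q` maximal ⇒ the local ring of `C/(f)` at `Q/(f)` is not regular (tree
  `not_isRegularLocalRing_localization_quotient_of_mem_sq`, Matsumura Thm 14.2).
* `isRegularLocalRing_of_isRegular_affineBlowup_span_singleton`,
  `not_isRegular_affineBlowup_span_singleton` — `Bl_(f)(Spec A) → Spec A` is an isomorphism for a
  nonzerodivisor `f` (landed `isIso_affineBlowup_π_span_singleton`), so `Bl_(f)` regular forces every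
  `A_𝔭` regular: **at a singular variety no principal centre has a regular blowing up.**
* `not_weakOneShotBody_two_principal` — for every prime `p`: NOT every integral affine curve over a
  field of characteristic `p` has a nonzero `f` with `Bl_(f)` regular (witness: the nodal cubic over
  `𝔽_p`); `not_oneShotBody_two_principal` — a fortiori the level-`2` body of the route's `OneShot`
  (which adds `V(f) = Sing`) is not met by principal centres.

## Sources
* H. Matsumura, *Commutative Ring Theory*, CUP 1986, Thm 14.2 (a regular local ring modulo an
  element of `𝔪²` is not regular). [Matsumura1987]
* R. Hartshorne, *Algebraic Geometry*, GTM 52, I Ex. 5.1 / Thm 5.1 (the node `y² = x²(x-1)`-type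
  plane cubics are singular at the origin; Jacobian criterion). [Hartshorne1977]
-/

noncomputable section

set_option linter.dupNamespace false -- mandated namespace of this single-conjunct summit

open CategoryTheory AlgebraicGeometry TopologicalSpace
open Literature.AlgebraicGeometry.Resolution
open Summit.ResolutionOfSingularities.ResolutionOfSingularities.Theses.SectionAscent
open Polynomial
open scoped Polynomial.Bivariate

namespace Summit.ResolutionOfSingularities.ResolutionOfSingularities.Theorems.FibrewiseClosedPoints.Negative

universe u

section Curve

variable (k : Type) [Field k]

/-- **The nodal cubic `Y² - X²(X - 1)` is irreducible over every field** (Eisenstein at the prime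
`(X - 1)` of `k[X]`: monic in `Y`, lower coefficients `0` and `-X²(X-1)` in `(X - 1)`, and
`-X²(X-1) ∉ (X-1)²` because `1` is not a root of `X²`). [folklore] -/
theorem irreducible_nodalCubic :
    Irreducible (Y ^ 2 - C (X ^ 2 * (X - C 1)) : k[X][Y]) := by
  set r : k[X] := X ^ 2 * (X - C 1) with hr
  have hmonic : (Y ^ 2 - C r : k[X][Y]).Monic := monic_X_pow_sub_C r two_ne_zero
  have hdeg : (Y ^ 2 - C r : k[X][Y]).natDegree = 2 := natDegree_X_pow_sub_C
  -- the prime `(X - 1)` of `k[X]`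
  set 𝓟 : Ideal k[X] := Ideal.span {X - C 1} with h𝓟
  have hprime : 𝓟.IsPrime := by
    rw [h𝓟, Ideal.span_singleton_prime (X_sub_C_ne_zero (1 : k))]
    exact prime_X_sub_C (1 : k)
  have heis : (Y ^ 2 - C r : k[X][Y]).IsEisensteinAt 𝓟 := by
    refine ⟨?_, ?_, ?_⟩
    · rw [hmonic.leadingCoeff]
      exact fun h1 => hprime.ne_top ((Ideal.eq_top_iff_one _).mpr h1)
    · intro n hn
      rw [hdeg] at hn
      interval_cases n
      · -- constant coefficient `-r ∈ (X - 1)`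
        have : (Y ^ 2 - C r : k[X][Y]).coeff 0 = -r := by
          simp [coeff_sub, coeff_X_pow, coeff_C]
        rw [this, h𝓟]
        exact neg_mem_iff.mpr (Ideal.mem_span_singleton.mpr ⟨X ^ 2, by rw [hr]; ring⟩)
      · have : (Y ^ 2 - C r : k[X][Y]).coeff 1 = 0 := by
          simp [coeff_sub, coeff_X_pow]
        rw [this]
        exact Ideal.zero_mem _
    · -- `-r ∉ (X - 1)²`: otherwise `(X - 1) ∣ X²`, i.e. `1` is a root of `X²`
      have h0 : (Y ^ 2 - C r : k[X][Y]).coeff 0 = -r := by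
        simp [coeff_sub, coeff_X_pow, coeff_C]
      rw [h0, h𝓟, Ideal.span_singleton_pow, neg_mem_iff, Ideal.mem_span_singleton]
      rintro ⟨q, hq⟩
      have hdvd : (X - C 1 : k[X]) ∣ X ^ 2 := by
        have hne : (X - C (1 : k)) ≠ 0 := X_sub_C_ne_zero 1
        refine ⟨q, mul_left_cancel₀ hne ?_⟩
        calc (X - C 1) * X ^ 2 = r := by rw [hr]; ring
          _ = (X - C 1) * ((X - C 1) * q) := by rw [hq]; ring
      have := (dvd_iff_isRoot.mp hdvd)
      simp at this
  exact heis.irreducible hprime hmonic.isPrimitive (by rw [hdeg]; exact two_pos)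

/-- The nodal cubic is a nonzero (monic in `Y`) polynomial. [folklore] -/
theorem nodalCubic_ne_zero : (Y ^ 2 - C (X ^ 2 * (X - C 1)) : k[X][Y]) ≠ 0 :=
  (monic_X_pow_sub_C (X ^ 2 * (X - C 1) : k[X]) two_ne_zero).ne_zero

/-- The coordinate ring `k[X][Y]/(Y² - X²(X-1))` of the nodal cubic is a domain. [folklore] -/
theorem isDomain_nodalCubic :
    IsDomain (k[X][Y] ⧸ Ideal.span {(Y ^ 2 - C (X ^ 2 * (X - C 1)) : k[X][Y])}) := by
  haveI : (Ideal.span {(Y ^ 2 - C (X ^ 2 * (X - C 1)) : k[X][Y])}).IsPrime :=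
    (Ideal.span_singleton_prime (nodalCubic_ne_zero k)).mpr (irreducible_nodalCubic k).prime
  exact Ideal.Quotient.isDomain _

/-- The nodal cubic passes through the origin singularly: `f ∈ 𝔪_0²`, `𝔪_0 = ker (evalEval 0 0)`.
[folklore] -/
theorem nodalCubic_mem_ker_evalEval_sq :
    (Y ^ 2 - C (X ^ 2 * (X - C 1)) : k[X][Y]) ∈ RingHom.ker (evalEvalRingHom (0 : k) 0) ^ 2 := by
  set Q : Ideal k[X][Y] := RingHom.ker (evalEvalRingHom (0 : k) 0) with hQ
  have hY : (Y : k[X][Y]) ∈ Q := by simp [hQ, RingHom.mem_ker]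
  have hX : (C X : k[X][Y]) ∈ Q := by simp [hQ, RingHom.mem_ker]
  have h1 : (Y : k[X][Y]) ^ 2 ∈ Q ^ 2 := Ideal.pow_mem_pow hY 2
  have h2 : (C X : k[X][Y]) ^ 2 * (C X - C (C 1)) ∈ Q ^ 2 :=
    Ideal.mul_mem_right _ _ (Ideal.pow_mem_pow hX 2)
  have hf' : (Y ^ 2 - C (X ^ 2 * (X - C 1)) : k[X][Y]) = Y ^ 2 - (C X) ^ 2 * (C X - C (C 1)) := by
    rw [map_mul, map_sub, map_pow]
  rw [hf']
  exact sub_mem h1 h2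

/-- The origin is a closed point: `ker (evalEval 0 0)` is a maximal ideal of `k[X][Y]`. [folklore] -/
theorem isMaximal_ker_evalEval : (RingHom.ker (evalEvalRingHom (0 : k) 0)).IsMaximal := by
  refine RingHom.ker_isMaximal_of_surjective _ fun c => ⟨C (C c), ?_⟩
  simp

end Curve

/-- **A hypersurface is singular at a closed point of `V(f) ∩ V(𝔪²)`** (generic form, so that
the instance paths of the quotient agree with the consumers): in a regular domain `C`, if
`0 ≠ f ∈ Q²` for a maximal ideal `Q`, then the local ring of `C/(f)` at the prime `Q/(f)` is not
regular (tree `not_isRegularLocalRing_localization_quotient_of_mem_sq`, Matsumura Thm 14.2).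
[cite: Matsumura1987, Thm 14.2] -/
theorem exists_not_isRegularLocalRing_of_mem_sq {C : Type u} [CommRing C] [IsDomain C]
    [IsRegularRing C] {f : C} (hf0 : f ≠ 0) {Q : Ideal C} (hQ : Q.IsMaximal) (hfQ2 : f ∈ Q ^ 2) :
    ∃ P : PrimeSpectrum (C ⧸ Ideal.span {f}), ¬ IsRegularLocalRing (Localization.AtPrime P.asIdeal) := by
  have hfQ : f ∈ Q := Ideal.pow_le_self two_ne_zero hfQ2
  set mk := Ideal.Quotient.mk (Ideal.span {f}) with hmk
  have hcomap : (Q.map mk).comap mk = Q := by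
    rw [Ideal.comap_map_of_surjective _ Ideal.Quotient.mk_surjective, ← RingHom.ker_eq_comap_bot,
      Ideal.mk_ker, sup_eq_left]
    exact (Ideal.span_singleton_le_iff_mem Q).mpr hfQ
  have hPmax : (Q.map mk).IsMaximal := by
    rcases Ideal.map_eq_top_or_isMaximal_of_surjective mk
      (Ideal.Quotient.mk_surjective (I := Ideal.span {f})) hQ with h | h
    · exfalso
      apply hQ.ne_top
      rw [← hcomap, h, Ideal.comap_top]
    · exact h
  refine ⟨⟨Q.map mk, hPmax.isPrime⟩, ?_⟩
  haveI := hPmax.isPrime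
  have hf2 : f ∈ (Q.map mk).comap (Ideal.Quotient.mk (Ideal.span {f})) ^ 2 := by
    rw [← hmk, hcomap]
    exact hfQ2
  exact not_isRegularLocalRing_localization_quotient_of_mem_sq hf0 _ hf2

section Curve

variable (k : Type) [Field k]

/-- The coordinate ring of the nodal cubic has Krull dimension `< 2` (it is `k[X][Y]/(f)` with
`f ≠ 0`, and `dim k[X][Y] = 2`). [folklore] -/
theorem ringKrullDim_nodalCubic_lt_two :
    ringKrullDim (k[X][Y] ⧸ Ideal.span {(Y ^ 2 - C (X ^ 2 * (X - C 1)) : k[X][Y])}) <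
      ((2 : ℕ) : WithBot ℕ∞) := by
  set A := k[X][Y] ⧸ Ideal.span {(Y ^ 2 - C (X ^ 2 * (X - C 1)) : k[X][Y])}
  have h2 : ringKrullDim k[X][Y] = 2 := by
    rw [Polynomial.ringKrullDim_of_isNoetherianRing, Polynomial.ringKrullDim_of_isNoetherianRing,
      ringKrullDim_eq_zero_of_field]
    rfl
  have hle : ringKrullDim A + 1 ≤ ringKrullDim k[X][Y] :=
    ringKrullDim_quotient_succ_le_of_nonZeroDivisor
      (mem_nonZeroDivisors_of_ne_zero (nodalCubic_ne_zero k))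
  rw [h2] at hle
  haveI : Algebra.FiniteType k A := inferInstance
  haveI : IsDomain A := isDomain_nodalCubic k
  obtain ⟨n, hn, -⟩ := exists_ringKrullDim_eq_and_trdeg_eq k A
  rw [hn] at hle ⊢
  have hn1 : n + 1 ≤ 2 := by exact_mod_cast hle
  exact_mod_cast (show n < 2 by omega)

end Curve

/-! ## Principal centres never resolve -/

/-- **Blowing up a principal centre changes nothing**: if `Bl_(f)(Spec A)` (`f` a
nonzerodivisor) is regular then every local ring `A_𝔭` is regular, because
`Bl_(f)(Spec A) → Spec A` is an isomorphism (landed `isIso_affineBlowup_π_span_singleton`).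
[folklore] -/
theorem isRegularLocalRing_of_isRegular_affineBlowup_span_singleton {A : Type u} [CommRing A]
    {f : A} (hf : f ∈ nonZeroDivisors A)
    (hreg : Scheme.IsRegular (affineBlowup (Ideal.span {f}))) (𝔭 : PrimeSpectrum A) :
    IsRegularLocalRing (Localization.AtPrime 𝔭.asIdeal) := by
  haveI hiso : IsIso (affineBlowup.π (Ideal.span {f})) := isIso_affineBlowup_π_span_singleton hf
  set π := affineBlowup.π (Ideal.span {f}) with hπ
  -- the point of the blowing up over `𝔭`
  let e := Scheme.homeoOfIso (asIso π)
  let y : Spec (.of A) := 𝔭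
  let x : affineBlowup (Ideal.span {f}) := e.symm y
  have hxy : π.base x = y := e.apply_symm_apply y
  haveI : IsRegularLocalRing ((affineBlowup (Ideal.span {f})).presheaf.stalk x) := hreg x
  haveI hst : IsRegularLocalRing ((Spec (.of A)).presheaf.stalk (π.base x)) :=
    IsRegularLocalRing.of_ringEquiv (asIso (π.stalkMap x)).commRingCatIsoToRingEquiv.symm
  rw [hxy] at hst
  letI : Algebra A ((Spec (.of A)).presheaf.stalk y) :=
    inferInstanceAs (Algebra A ((Spec.structureSheaf A).presheaf.stalk y))
  haveI : IsLocalization.AtPrime ((Spec (.of A)).presheaf.stalk y) y.asIdeal :=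
    StructureSheaf.IsLocalization.to_stalk A y
  exact IsRegularLocalRing.of_ringEquiv
    (IsLocalization.algEquiv y.asIdeal.primeCompl ((Spec (.of A)).presheaf.stalk y)
      (Localization.AtPrime y.asIdeal)).toRingEquiv

/-- Contrapositive: **at a singular variety no principal centre has a regular blowing up.**
[folklore] -/
theorem not_isRegular_affineBlowup_span_singleton {A : Type u} [CommRing A] [IsDomain A]
    {𝔭 : PrimeSpectrum A} (h𝔭 : ¬ IsRegularLocalRing (Localization.AtPrime 𝔭.asIdeal))
    {f : A} (hf : f ≠ 0) : ¬ Scheme.IsRegular (affineBlowup (Ideal.span {f})) :=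
  fun hreg => h𝔭 (isRegularLocalRing_of_isRegular_affineBlowup_span_singleton
    (mem_nonZeroDivisors_of_ne_zero hf) hreg 𝔭)

/-- **The conclusion of the crux is not junk-satisfiable: even WEAK one-shot resolution fails
with principal centres, already for curves.** For every prime `p` it is FALSE that every integral
affine curve over a field of characteristic `p` has a nonzero `f` with `Bl_(f)` regular: the
nodal cubic `Y² = X²(X - 1)` over `𝔽_p` (irreducible by Eisenstein at `(X - 1)`, singular at the
origin by `f ∈ 𝔪_0²`) has none, `Bl_(f) ≅ Spec A` being singular with `A`. Contrast: the
HYPOTHESIS `Almost` of the crux IS met by principal centres on normal varieties (landed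
`almostBody_span_singleton`), and `V(I) = Sing` forces `I` non-invertible at singular points.
[folklore] -/
theorem not_weakOneShotBody_two_principal (p : ℕ) [hp : Fact p.Prime] :
    ¬ ∀ (K : Type) [Field K] [CharP K p] (A : Type) [CommRing A] [IsDomain A] [Algebra K A]
        [Algebra.FiniteType K A], ringKrullDim A < ((2 : ℕ) : WithBot ℕ∞) →
        ∃ f : A, f ≠ 0 ∧ Scheme.IsRegular (affineBlowup (Ideal.span {f})) := by
  intro h
  let K := ZMod p
  let A := K[X][Y] ⧸ Ideal.span {(Y ^ 2 - C (X ^ 2 * (X - C 1)) : K[X][Y])}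
  haveI : IsDomain A := isDomain_nodalCubic K
  haveI : CharP A p :=
    charP_of_injective_algebraMap (algebraMap K A).injective p
  haveI : Algebra.FiniteType K A := inferInstance
  obtain ⟨f, hf, hreg⟩ := h K A (ringKrullDim_nodalCubic_lt_two K)
  obtain ⟨P, hnreg⟩ := exists_not_isRegularLocalRing_of_mem_sq (nodalCubic_ne_zero K)
    (isMaximal_ker_evalEval K) (nodalCubic_mem_ker_evalEval_sq K)
  exact not_isRegular_affineBlowup_span_singleton (𝔭 := P) hnreg hf hreg

/-- Hence the level-`2` body of `OneShot` (curves) cannot be met by principal centres either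
(it asks more: exact support). Any proof of the crux must produce, at level `d + 1 ≥ 2`, centres
that are NOT invertible at the singular points — unlike the junk that inhabits `Almost`.
[folklore] -/
theorem not_oneShotBody_two_principal (p : ℕ) [Fact p.Prime] :
    ¬ ∀ (K : Type) [Field K] [CharP K p] (A : Type) [CommRing A] [IsDomain A] [Algebra K A]
        [Algebra.FiniteType K A], ringKrullDim A < ((2 : ℕ) : WithBot ℕ∞) →
        ∃ f : A, f ≠ 0 ∧ Scheme.IsRegular (affineBlowup (Ideal.span {f})) ∧
          ∀ 𝔭 : PrimeSpectrum A, Ideal.span {f} ≤ 𝔭.asIdeal ↔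
            ¬ IsRegularLocalRing (Localization.AtPrime 𝔭.asIdeal) := by
  intro h
  refine not_weakOneShotBody_two_principal p fun K _ _ A _ _ _ _ hdim => ?_
  obtain ⟨f, hf, hreg, -⟩ := h K A hdim
  exact ⟨f, hf, hreg⟩


end Summit.ResolutionOfSingularities.ResolutionOfSingularities.Theorems.FibrewiseClosedPoints.Negative

end
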